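import Mathlib
import Summits.ValiantsHypothesis.ValiantsHypothesis.Theorems.DivisionGapPerMultiplesHardRelDenseHost
import Summits.ValiantsHypothesis.ValiantsHypothesis.Theorems.DivisionGapPerMultiplesHardStubTwoBandTable
import Summits.ValiantsHypothesis.ValiantsHypothesis.Theorems.DivisionGapPerMultiplesHardStubCompleteClassRung
import Summits.ValiantsHypothesis.ValiantsHypothesis.Theorems.DivisionGapPerMultiplesHardThinPatterns
import Summits.ValiantsHypothesis.ValiantsHypothesis.Theorems.DivisionGapPerMultiplesHardStubBoardCompression
import Summits.ValiantsHypothesis.ValiantsHypothesis.Theorems.DivisionGapPerMultiplesHardPushOff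
import Literature.Computability.AlgebraicComplexity.ArithCircuitProofs
import Literature.Computability.AlgebraicComplexity.PermanentIrreducible

/-!
# `DivisionGap.PerMultiplesHard` (stmt-ValiantsHypothesis-5068), line `uncharged-face-walk`:
the dense-host complete-class rung `relDenseCompleteClassHard`

Let `per_G := Σ_{σ inside G} x^{μ_σ}` be the face permanent of a host `G ⊆ [n]²` (cells
`(row, column)`; `σ` is inside `G` when `(σ i, i) ∈ G` for every column `i`), and let
`Y := {(a, b) ∈ G : (ζ⁻¹ a, b) ∈ G}` (`ζ = finRotate n`) be its shift intersection `G ∩ ζ G`.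
Assume van der Waerden's permanent bound (spelled out as the first hypothesis), that `Y` contains
an `f`-regular spanning subgraph `Y'` (`f ≥ 1`) and satisfies the upper mixing bound
`e_Y(A, B) ≤ β · #A · #B + ε · n²`, and that the cofactor `t ∈ ℝ≥0[x_ij]` is torus-homogeneous
with balanced, close margins `(R, C)` of offset `> n²` whose support contains EVERY `G`-supported
table with these margins (the complete class on the host).  Then

  `f^n · 5^{⌊n/10⌋} ≤ L(per_G · t) · (β n)^n · 4^{⌊n/10⌋} · exp (15 ε n / β + (log n + 12) / β)`.

Proof (composition of tree theorems of the line).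
* `g := per_G · t` is torus-homogeneous with margins `(R + 1, C + 1)` (`margins_facePer_mul`:
  supports add over `ℝ≥0` and every exponent of `per_G` is a permutation matrix), all rows hit.
* For a permutation `π` inside `Y`, `TwoBandTable.stub_twoBandTable` gives a table `M` with
  margins `(R, C)` all of whose cells `(a, b)` satisfy `π b = a ∨ π b = ζ a`; such cells lie in
  `G` (`(π b, b) ∈ Y ⊆ G`, resp. `a = ζ⁻¹ (π b)` and `(ζ⁻¹ (π b), b) ∈ G`), so `M ∈ supp t` by
  completeness, and `μ_π + M ∈ supp g` is a `ζ`-spread probe for `π` (`probe_facePer_mul`).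
* `RelDenseHost.stub_relDenseHost` (host `Y`, subgraph `Y'`, shift `ζ`, polynomial `g`,
  margins `(R + 1, C + 1)`) is the conclusion.
-/

noncomputable section

-- `Summit.ValiantsHypothesis.ValiantsHypothesis.…` is the tree's mandated layout (Sub = Summit).
set_option linter.dupNamespace false

namespace Summit.ValiantsHypothesis.ValiantsHypothesis.Theorems.DivisionGap.PerMultiplesHard.RelDenseCompleteClass

open MvPolynomial Literature.Computability.AlgebraicComplexity
open scoped NNReal BigOperators

/-! ### Margins and probes of `per_G · t` -/

/-- `per_G · q` is torus-homogeneous with margins `(r + 1, cc + 1)` when `q` has margins `(r, cc)`: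
supports add over `ℝ≥0` and every exponent of the face permanent is a permutation matrix.
[folklore] -/
theorem margins_facePer_mul {n : ℕ} (G : Finset (Fin n × Fin n))
    {q : MvPolynomial (Fin n × Fin n) ℝ≥0} {r cc : Fin n → ℕ}
    (hq : ∀ m ∈ q.support, (∀ i, ∑ j, m (i, j) = r i) ∧ (∀ j, ∑ i, m (i, j) = cc j)) :
    ∀ m ∈ ((∑ σ ∈ (Finset.univ : Finset (Equiv.Perm (Fin n))).filter (fun σ => ∀ i, (σ i, i) ∈ G),
        monomial (permMonomial σ) (1 : ℝ≥0)) * q).support,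
      (∀ i, ∑ j, m (i, j) = r i + 1) ∧ (∀ j, ∑ i, m (i, j) = cc j + 1) := by
  classical
  intro m hm
  obtain ⟨u, hu, A, hA, rfl⟩ := Finset.mem_add.mp (MvPolynomial.support_mul _ _ hm)
  obtain ⟨σ, -, rfl⟩ := PushOff.mem_support_facePer.1 hu
  obtain ⟨hr, hc⟩ := hq A hA
  refine ⟨fun i => ?_, fun j => ?_⟩
  · have h1 : ∑ j, permMonomial σ (i, j) = 1 := rowCount_permMonomial σ i
    have h2 := hr i
    simp only [Finsupp.coe_add, Pi.add_apply, Finset.sum_add_distrib, h1, h2]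
    omega
  · have h1 : ∑ i, permMonomial σ (i, j) = 1 := colCount_permMonomial σ j
    have h2 := hc j
    simp only [Finsupp.coe_add, Pi.add_apply, Finset.sum_add_distrib, h1, h2]
    omega

/-- **Probes lift through `per_G`.**  If `π` lies inside `G` and `M ∈ supp t` is a `ζ`-spread
probe for `π`, then `μ_π + M ∈ supp (per_G · t)` is a `ζ`-spread probe for `π` (no cancellation
over `ℝ≥0`; the cells of `μ_π` are the cells `(π b, b)`). [folklore] -/
theorem probe_facePer_mul {n : ℕ} (G : Finset (Fin n × Fin n)) {ζ : Equiv.Perm (Fin n)}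
    {t : MvPolynomial (Fin n × Fin n) ℝ≥0} (π : Equiv.Perm (Fin n)) (hπ : ∀ i, (π i, i) ∈ G)
    {M : (Fin n × Fin n) →₀ ℕ} (hM : M ∈ t.support)
    (hprobe : ∀ e ∈ M.support, π e.2 = e.1 ∨ π e.2 = ζ e.1) :
    ∃ m ∈ ((∑ σ ∈ (Finset.univ : Finset (Equiv.Perm (Fin n))).filter (fun σ => ∀ i, (σ i, i) ∈ G),
        monomial (permMonomial σ) (1 : ℝ≥0)) * t).support,
      ∀ e ∈ m.support, π e.2 = e.1 ∨ π e.2 = ζ e.1 := by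
  classical
  refine ⟨permMonomial π + M,
    ThinPatterns.add_mem_support_mul (PushOff.mem_support_facePer.2 ⟨π, hπ, rfl⟩) hM, ?_⟩
  rintro ⟨r, c⟩ he
  rcases Finset.mem_union.mp (Finsupp.support_add he) with h | h
  · left
    have h' := Finsupp.mem_support_iff.mp h
    rw [permMonomial_apply] at h'
    by_contra hne
    exact h' (if_neg hne)
  · exact hprobe _ h

/-! ### The rung -/

/-- **The dense-host complete-class rung (conditional on van der Waerden).**  Let `G ⊆ [n]²`
(`n ≥ 5`) be a host whose shift intersection `Y = {(a, b) ∈ G : ((finRotate n)⁻¹ a, b) ∈ G}`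
contains an `f`-regular spanning subgraph `Y'` (`f ≥ 1`) and satisfies the upper mixing bound
`e_Y(A, B) ≤ β · #A · #B + ε · n²` (`0 < β ≤ 1`, `0 ≤ ε ≤ 1`), and let `t` be torus-homogeneous
with margins `(R, C)` balanced, close and of offset `> n²`, whose support contains every
`G`-supported table with these margins (the complete class on the host).  Then, given van der
Waerden's permanent bound,
`f^n · 5^{⌊n/10⌋} ≤ L(per_G · t) · (β n)^n · 4^{⌊n/10⌋} · exp (15 ε n / β + (log n + 12) / β)`.
Proof: every permutation `π` inside `Y` carries a `finRotate`-spread probe in `supp (per_G · t)`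
(`TwoBandTable.stub_twoBandTable` gives a two-band table with margins `(R, C)`, its cells lie in
`G`, completeness puts it in `supp t`, `probe_facePer_mul` lifts it), `per_G · t` has margins
`(R + 1, C + 1)` (`margins_facePer_mul`), and `RelDenseHost.stub_relDenseHost` (relative spread
engine + Brégman–Minc fibres + the Jerrum–Snir-type window count) concludes.
[cite: JerrumSnir1982, §3–4] -/
theorem relDenseCompleteClassHard :
    (∀ (m : ℕ) (A : Matrix (Fin m) (Fin m) ℝ), (∀ i j, 0 ≤ A i j) →
      (∀ i, ∑ j, A i j = 1) → (∀ j, ∑ i, A i j = 1) →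
      (m.factorial : ℝ) ≤ (m : ℝ) ^ m * A.permanent) →
    ∀ n ≥ 5, ∀ (G Y' : Finset (Fin n × Fin n)) (f : ℕ),
      Y' ⊆ G.filter (fun e => ((finRotate n).symm e.1, e.2) ∈ G) → 1 ≤ f →
      (∀ i : Fin n, (Finset.univ.filter fun j : Fin n => (i, j) ∈ Y').card = f) →
      (∀ j : Fin n, (Finset.univ.filter fun i : Fin n => (i, j) ∈ Y').card = f) →
      ∀ (β ε : ℝ), 0 < β → β ≤ 1 → 0 ≤ ε → ε ≤ 1 →
      (∀ A B : Finset (Fin n),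
        (((G.filter (fun e => ((finRotate n).symm e.1, e.2) ∈ G)).filter fun e => e.1 ∈ A ∧ e.2 ∈ B).card : ℝ) ≤
          β * A.card * B.card + ε * (n : ℝ) ^ 2) →
      ∀ (t : MvPolynomial (Fin n × Fin n) ℝ≥0) (R C : Fin n → ℕ),
        (∀ m ∈ t.support, (∀ i, ∑ j, m (i, j) = R i) ∧ (∀ j, ∑ i, m (i, j) = C j)) →
        (∀ M : (Fin n × Fin n) →₀ ℕ, M.support ⊆ G →
          (∀ i, ∑ j, M (i, j) = R i) → (∀ j, ∑ i, M (i, j) = C j) → M ∈ t.support) →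
        ∑ i, R i = ∑ j, C j → (∀ i j, R i ≤ C j + n ∧ C j ≤ R i + n) → (∀ i, n ^ 2 + 1 ≤ R i) →
        (f : ℝ) ^ n * (5 : ℝ) ^ (n / 10) ≤
          (complexity ((∑ σ ∈ (Finset.univ : Finset (Equiv.Perm (Fin n))).filter (fun σ => ∀ i, (σ i, i) ∈ G),
              monomial (permMonomial σ) (1 : ℝ≥0)) * t) : ℝ) * (β * n) ^ n * (4 : ℝ) ^ (n / 10) *
            Real.exp (15 * ε * n / β + (Real.log n + 12) / β) := by
  classical
  intro hvdW n hn G Y' f hY' hf hrow hcol β ε hβ hβ1 hε hε1 hmix t R C ht hfull hbal hclose hoff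
  -- every permutation inside `Y = G ∩ rot G` carries a `finRotate`-spread probe in `supp (per_G · t)`
  have hprobe : ∀ π : Equiv.Perm (Fin n),
      (∀ j, (π j, j) ∈ G.filter (fun e => ((finRotate n).symm e.1, e.2) ∈ G)) →
      ∃ m ∈ ((∑ σ ∈ (Finset.univ : Finset (Equiv.Perm (Fin n))).filter (fun σ => ∀ i, (σ i, i) ∈ G),
          monomial (permMonomial σ) (1 : ℝ≥0)) * t).support,
        ∀ e ∈ m.support, π e.2 = e.1 ∨ π e.2 = finRotate n e.1 := by
    intro π hπ
    have hπG : ∀ j, (π j, j) ∈ G := fun j => (Finset.mem_filter.mp (hπ j)).1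
    have hπG' : ∀ j, ((finRotate n).symm (π j), j) ∈ G := fun j => (Finset.mem_filter.mp (hπ j)).2
    obtain ⟨M, hMprobe, hMR, hMC⟩ := TwoBandTable.stub_twoBandTable n π R C hbal hclose hoff
    have hMsupp : M.support ⊆ G := by
      intro e he
      rcases hMprobe e he with h1 | h2
      · have : e = (π e.2, e.2) := by rw [h1]
        rw [this]
        exact hπG e.2
      · have h3 : (finRotate n).symm (π e.2) = e.1 := by
          rw [h2]; exact (finRotate n).symm_apply_apply e.1
        have : e = ((finRotate n).symm (π e.2), e.2) := by rw [h3]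
        rw [this]
        exact hπG' e.2
    exact probe_facePer_mul G π hπG (hfull M hMsupp hMR hMC) hMprobe
  exact RelDenseHost.stub_relDenseHost hvdW n hn _ Y' f hY' hf hrow hcol β ε hβ hβ1 hε hε1 hmix
    (finRotate n) _ (fun i => R i + 1) (fun j => C j + 1) (margins_facePer_mul G ht)
    (fun i => Nat.succ_ne_zero _) hprobe

end Summit.ValiantsHypothesis.ValiantsHypothesis.Theorems.DivisionGap.PerMultiplesHard.RelDenseCompleteClass

end
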